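import Literature.RepresentationTheory.MoeglinVignerasWaldspurger1987.RankOneThetaLiftLineTypeCriterion
import Literature.RepresentationTheory.MoeglinVignerasWaldspurger1987.RankOneThetaTypesComplementOfTraceRelation
import HarnessLib

/-!
# Rank-one theta lifts through a line from TWO lines are DISJOINT as soon as their FIRST-BLOCK oscillator representations have
# COMPLEMENTARY type sets — the see-saw reduction of theta dichotomy to `(U(1), U(1))` (non-split place, any second block)

[MoeglinVignerasWaldspurger1987] C. Mœglin, M.-F. Vignéras, J.-L. Waldspurger, *Correspondances de Howe sur un corps `p`-adique*, LNM 1291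
(1987), Chap. 2 II.1 Rem. (6) (`ω|_{Sp(𝕎₁)×Sp(𝕎₂)} = ω₁ ⊗ ω₂`) and Chap. 3 §IV.4 (the `(U(1), U(1))` dichotomy); read for the unitary see-saw
`U(J₁) × U(J₂) ⊂ U(J₁ ⊕ J₂)` of [Kudla1984, §1].  Topic `RepresentationTheory/MoeglinVignerasWaldspurger1987`; namespace
`Literature.RepresentationTheory.MoeglinVignerasWaldspurger1987`; companion of ★ `RankOneThetaLiftLineTypeCriterion` (ONE line `δ`, ONE section `s`),
here with TWO trace-zero data `δ₁, δ₂` and TWO sections `s₁` (over `ι_{δ₁}`) and `s₂` (over `ι_{δ₂}`) on the SAME group `U(J)(F_v)`,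
`J = (T₁ ⊕ T₂) ⊗ 1` with `T₁` a `1 × 1` Gram matrix (first block a LINE) and `T₂` of any size `n₂`.  THEOREMS ONLY (no definition, no named fact,
no `sorry`, no instance, no notation).  Cell `hodgecm-mathlib`, half-A line LD2 (socket `stub_S1b_facts`, books row #74R), the R₂ in-house road
(dealer LD2-plan (g2) DEALS #2, plate (α*)); `--supports stmt-HodgeConjecture-24832`.

WHAT IS PROVED.
* §0 `nontrivial_coinv_comp_iff_of_areIsomorphicRep` (generic): isomorphic representations of `G` have simultaneously (non-)zero
  `ξ`-coinvariants after restriction along any `i : H →* G` (★ `TwistedCoinv.mapEquiv`; the same six lines are `private` in ★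
  `RankOneThetaLiftTwistRigidBlock`, made public here).
* §1 **`rankOne_theta_lines_disjoint_of_blockComplement`** — the ENGINE of the anisotropic half of [Liu2021, Lem. D.1 (4)] on the cell's road: if NO
  open-kernel unitary continuous character `ξ` of the compact torus `U(J₁)(F_v) = E_v¹` is a type of BOTH first-block oscillator representations
  `ω^{T₁} ∘ restrictLeft s₁` and `ω^{T₁} ∘ restrictLeft s₂` («block-0 complementarity», the conclusion of ★ `rankOne_theta_dichotomy` at `θ = 1`, i.e. of
  the rank-one CONSERVATION `m⁺ + m⁻ = 4` for `U(1)` [HarrisKudlaSweet1996, Cor. 4.4 ∕ Thm. 6.1; SunZhu2014, Thm. 1.10]), then a NON-ZERO `Θ_{s₁}(χ₁)`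
  is never isomorphic to `Θ_{s₂}(χ₂)` as a representation of `U(J)(F_v)`, for ANY centre characters `χ₁, χ₂`.  Proof (see-saw, no isotropy, no class
  hypothesis, no rank restriction): by ★ `nontrivial_theta_iff_exists_lineType` a non-zero `Θ_{s₁}(χ₁)` has a first-block type `ξ` with
  `Coinv_ξ(ω_{s₁,1}) ≠ 0` and a matching second-block coinvariant; ★ `coinvLineEquiv` makes the `ξ`-coinvariants of `Θ_{s₁}(χ₁)|_{U(J₁)}` non-zero; §0
  transports this along the isomorphism to `Θ_{s₂}(χ₂)|_{U(J₁)}`; ★ `coinvLineEquiv` for `s₂` splits it, so `ξ` is a type of `ω_{s₂,1}` too — contradicting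
  complementarity.
* §2 (edition 2) `blockComplement_of_finrank_weightSpace_add_eq_one` — consumer glue for the organ (P′): the complementarity hypothesis `hcomp` of §1 from
  the `θ = 1` reading of ★ `rankOne_theta_dichotomy` on the two block sections (`dim ω₁[ξ] + dim ω₂[ξ] = 1` for every open-kernel `ξ`), via the compact-torus
  dictionary ★ `bijective_mk_domRestrict_weightSpace` and multiplicity one ★ `finiteDimensional_weightSpace_rankOne` (`restrictLeft sᵢ` is a section over
  `ι^{T₁}_{δᵢ}` by ★ `proj_restrictLeft`, smooth by ★ `isSmooth_restrictLeft`).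
* §3 (edition 3) `rankOne_theta_lines_disjoint_of_blockZero_trace_eq_neg` — the COMPOSITE socket: ★ `rankOne_finrank_weightSpace_add_eq_one_of_trace_eq_neg`
  (`RankOneThetaTypesComplementOfTraceRelation`, θ = 1 trace relation ⇒ complementary dimensions) ∘ §2 ∘ §1, with the auxiliary Haar measure and conductor
  exponent supplied internally: «opposite block-0 traces (the (P′) socket, measure-free) ⇒ `Θ_{s₁}(χ₁) ≠ 0 ∧ Θ_{s₁}(χ₁) ≅ Θ_{s₂}(χ₂)` impossible».

HONEST LABEL.  Nothing of [Liu2021] is asserted: complementarity enters as the HYPOTHESIS `hcomp` (to be paid for the CM sections by the big-cell-scalar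
computation of the line LD2, organ (P′)).  HC_CM is proved only modulo the 7 printed citations (2 remaining: hLiu418 = stmt-HodgeConjecture-24832, h413 =
stmt-HodgeConjecture-24833) until rung 0 closes; count-neutral.

## References
* [MoeglinVignerasWaldspurger1987] LNM 1291 (1987), Chap. 2 II.1 Rem. (6); Chap. 3 §IV.4 Théorème principal.
* [Kudla1984] S. Kudla, *Seesaw dual reductive pairs*, Progr. Math. 46 (1984), §1.
* [HarrisKudlaSweet1996] M. Harris, S. Kudla, W. J. Sweet, *Theta dichotomy for unitary groups*, J. AMS 9 (1996), Cor. 4.4 (p. 962), Thm. 6.1 (p. 967).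
* [SunZhu2014] B. Sun, C.-B. Zhu, *Conservation relations for local theta correspondence*, J. AMS 28 (2015), Thm. 1.10.
* [Liu2021] Y. Liu, Camb. J. Math. 9 (2021) = arXiv:2102.11518, App. D Lem. D.1 (4) (p. 125–126).
* [GelbartRogawski1991] S. Gelbart, J. Rogawski, *L-functions and Fourier–Jacobi coefficients for the unitary group U(3)*, Invent. Math. 105 (1991),
  §3.1 Remark (p. 457).
-/

set_option autoImplicit false

noncomputable section

open NumberField IsDedekindDomain
open scoped TensorProduct Matrix
open Literature.RepresentationTheory.HeisenbergGroup (MpPsi)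
open Literature.RepresentationTheory.TwistedCoinv
open Literature.NumberTheory.GelbartRogawski1991.UnitaryDualPair.LocalSplitting
open Literature.NumberTheory.GelbartRogawski1991.UnitaryDualPair.LocalSplitting.BlockSum
open Literature.NumberTheory.Automorphic
open Literature.NumberTheory.Automorphic.Liu2021

namespace Literature.RepresentationTheory.MoeglinVignerasWaldspurger1987

/-! ## §0 Generic: coinvariants of restrictions are invariants of the isomorphism class -/

/-- **Isomorphic representations have simultaneously non-zero `ξ`-coinvariants after restriction along any `i : H →* G`**
(★ `TwistedCoinv.mapEquiv` along the isomorphism, twisting function `1`). [cite: GelbartRogawski1991, §3.1 Remark p. 457]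
[cite: MoeglinVignerasWaldspurger1987, Chap. 2 II.1 Rem. (6)] -/
theorem nontrivial_coinv_comp_iff_of_areIsomorphicRep {G H V₁ V₂ : Type*} [Group G] [Group H]
    [AddCommGroup V₁] [Module ℂ V₁] [AddCommGroup V₂] [Module ℂ V₂]
    {ρ₁ : Representation ℂ G V₁} {ρ₂ : Representation ℂ G V₂} (h : AreIsomorphicRep ρ₁ ρ₂) (i : H →* G)
    (ξ : H →* ℂˣ) : Nontrivial (Coinv (ρ₁.comp i) ξ) ↔ Nontrivial (Coinv (ρ₂.comp i) ξ) := by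
  obtain ⟨A, hA⟩ := h
  exact (mapEquiv (ρ₁.comp i) ξ (ρ₂.comp i) ξ A 1
    (fun u x => by rw [Pi.one_apply, Units.val_one, one_smul]; exact (hA (i u) x).symm)
    (fun u => (one_mul _).symm)).toEquiv.nontrivial_congr

/-! ## §1 The block setting with two lines: disjointness from first-block complementarity -/

variable (F : Type) [Field F] [NumberField F] (E : Type) [Field E] [NumberField E] [Algebra F E]
  [Algebra.IsQuadraticExtension F E] (c : E ≃ₐ[F] E)
  {δ₁ : E} (hcδ₁ : c δ₁ = -δ₁) (hδ₁ : δ₁ ≠ 0) {d₁ : F} (hd₁ : δ₁ * δ₁ = algebraMap F E d₁)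
  {δ₂ : E} (hcδ₂ : c δ₂ = -δ₂) (hδ₂ : δ₂ ≠ 0) {d₂ : F} (hd₂ : δ₂ * δ₂ = algebraMap F E d₂)
  (v : HeightOneSpectrum (𝓞 F)) (n₂ : ℕ)
  {T₁ : Matrix (Fin 1) (Fin 1) F} {T₂ : Matrix (Fin n₂) (Fin n₂) F} (hT₁ : T₁.IsSymm) (hT₂ : T₂.IsSymm)
  (hT₁d : IsUnit T₁.det) (hT₂d : IsUnit T₂.det)
  {J₁ : Matrix (Fin 1) (Fin 1) E} (hJ₁ : J₁ = T₁.map (algebraMap F E))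
  {J₂ : Matrix (Fin n₂) (Fin n₂) E} (hJ₂ : J₂ = T₂.map (algebraMap F E))
  {J : Matrix (Fin (1 + n₂)) (Fin (1 + n₂)) E} (hJ : J = (UnitaryGroup.finSum 1 n₂ T₁ T₂).map (algebraMap F E))
  (s₁ : UnitaryGroup.localPi E c (1 + n₂) J v →* LocalMp F (1 + n₂) (UnitaryGroup.finSum 1 n₂ T₁ T₂) v)
  (hs₁ : ∀ g, MpPsi.proj _ (s₁ g) =
    iota F E c (1 + n₂) hcδ₁ hδ₁ hd₁ (UnitaryGroup.finSum 1 n₂ T₁ T₂) (UnitaryGroup.isSymm_finSum hT₁ hT₂) hJ v g)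
  (s₂ : UnitaryGroup.localPi E c (1 + n₂) J v →* LocalMp F (1 + n₂) (UnitaryGroup.finSum 1 n₂ T₁ T₂) v)
  (hs₂ : ∀ g, MpPsi.proj _ (s₂ g) =
    iota F E c (1 + n₂) hcδ₂ hδ₂ hd₂ (UnitaryGroup.finSum 1 n₂ T₁ T₂) (UnitaryGroup.isSymm_finSum hT₁ hT₂) hJ v g)
  {J' : Matrix (Fin 1) (Fin 1) E} (hJ' : J' 0 0 ≠ 0)

-- two block-currency terms (two lines): about 2× the default budget, as in ★ `RankOneThetaLiftLineTypeCriterion`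
set_option maxHeartbeats 400000 in
include hT₁d hJ₂ in
/-- **RANK-ONE THETA LIFTS FROM TWO LINES ARE DISJOINT WHEN THEIR FIRST-BLOCK TYPE SETS ARE COMPLEMENTARY** (non-split place `v`, first block
a line, second block of any size `n₂`): if no open-kernel unitary continuous character `ξ` of `U(J₁)(F_v) = E_v¹` has non-zero coinvariants on BOTH
`ω^{T₁} ∘ restrictLeft s₁` and `ω^{T₁} ∘ restrictLeft s₂` (hypothesis `hcomp` — block-0 complementarity, the `θ = 1` case of ★
`rankOne_theta_dichotomy`, i.e. rank-one conservation), then `Θ_{s₁}(χ₁) = Coinv_{χ₁}(ω_{s₁} ∘ c_Z) ≠ 0` and an isomorphism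
`Θ_{s₁}(χ₁) ≅ Θ_{s₂}(χ₂)` of `U(J)(F_v)`-representations are INCOMPATIBLE, for any centre characters `χ₁, χ₂`.  See-saw proof: a first-block type `ξ`
of `Θ_{s₁}(χ₁)` (★ `nontrivial_theta_iff_exists_lineType`, ★ `coinvLineEquiv`) is carried by the isomorphism (§0) to a first-block type of
`Θ_{s₂}(χ₂)`, which ★ `coinvLineEquiv` for `s₂` splits into a type of `ω^{T₁} ∘ restrictLeft s₂`.
[cite: MoeglinVignerasWaldspurger1987, Chap. 2 II.1 Rem. (6); Chap. 3 §IV.4] [cite: Kudla1984, §1] [cite: HarrisKudlaSweet1996, Cor. 4.4 p. 962]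
[cite: SunZhu2014, Thm. 1.10] [cite: Liu2021, App. D Lemma D.1 (4) (p. 125–126)] -/
theorem rankOne_theta_lines_disjoint_of_blockComplement (hE : IsField (UnitaryGroup.LocalRing E v))
    (hsm₁ : Representation.IsSmooth ((MpPsi.toRep (localSchrodinger F (1 + n₂) (UnitaryGroup.finSum 1 n₂ T₁ T₂) v)).comp s₁))
    (χ₁ χ₂ : (UnitaryGroup.localPi E c 1 J' v) →* ℂˣ)
    (hcomp : ∀ ξ : (UnitaryGroup.localPi E c 1 J₁ v) →* ℂˣ, IsOpen (ξ.ker : Set (UnitaryGroup.localPi E c 1 J₁ v)) →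
      (∀ u, ‖((ξ u : ℂˣ) : ℂ)‖ = 1) → (Continuous fun u => ((ξ u : ℂˣ) : ℂ)) →
      Nontrivial (Coinv ((MpPsi.toRep (localSchrodinger F 1 T₁ v)).comp
        (restrictLeft F E c v 1 n₂ hJ₁ hJ hcδ₁ hδ₁ hd₁ hT₁ hT₂ hT₂d s₁ hs₁)) ξ) →
      Nontrivial (Coinv ((MpPsi.toRep (localSchrodinger F 1 T₁ v)).comp
        (restrictLeft F E c v 1 n₂ hJ₁ hJ hcδ₂ hδ₂ hd₂ hT₁ hT₂ hT₂d s₂ hs₂)) ξ) → False)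
    (hnt : Nontrivial (Coinv ((((MpPsi.toRep (localSchrodinger F (1 + n₂) (UnitaryGroup.finSum 1 n₂ T₁ T₂) v)).comp s₁)).comp
      (UnitaryGroup.localCenter E c (1 + n₂) J J' hJ' v)) χ₁))
    (hiso : AreIsomorphicRep
      (rep (ρW := (((MpPsi.toRep (localSchrodinger F (1 + n₂) (UnitaryGroup.finSum 1 n₂ T₁ T₂) v)).comp s₁)).comp
          (UnitaryGroup.localCenter E c (1 + n₂) J J' hJ' v)) χ₁
        ((MpPsi.toRep (localSchrodinger F (1 + n₂) (UnitaryGroup.finSum 1 n₂ T₁ T₂) v)).comp s₁)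
        (fun g z => (show Commute g ((UnitaryGroup.localCenter E c (1 + n₂) J J' hJ' v) z) from
          UnitaryGroup.localCenter_comm E c (1 + n₂) J J' hJ' v z g).map
            ((MpPsi.toRep (localSchrodinger F (1 + n₂) (UnitaryGroup.finSum 1 n₂ T₁ T₂) v)).comp s₁)))
      (rep (ρW := (((MpPsi.toRep (localSchrodinger F (1 + n₂) (UnitaryGroup.finSum 1 n₂ T₁ T₂) v)).comp s₂)).comp
          (UnitaryGroup.localCenter E c (1 + n₂) J J' hJ' v)) χ₂
        ((MpPsi.toRep (localSchrodinger F (1 + n₂) (UnitaryGroup.finSum 1 n₂ T₁ T₂) v)).comp s₂)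
        (fun g z => (show Commute g ((UnitaryGroup.localCenter E c (1 + n₂) J J' hJ' v) z) from
          UnitaryGroup.localCenter_comm E c (1 + n₂) J J' hJ' v z g).map
            ((MpPsi.toRep (localSchrodinger F (1 + n₂) (UnitaryGroup.finSum 1 n₂ T₁ T₂) v)).comp s₂)))) :
    False := by
  -- a first-block type `ξ` of the non-zero `Θ_{s₁}(χ₁)`, with its matching second-block coinvariant
  obtain ⟨ξ, hξo, hξu, hξc, h₁, h₂⟩ :=
    (nontrivial_theta_iff_exists_lineType F E c hcδ₁ hδ₁ hd₁ v n₂ hT₁ hT₂ hT₁d hT₂d hJ₁ hJ₂ hJ s₁ hs₁ hJ' hE hsm₁ χ₁).1 hnt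
  haveI := h₁
  haveI := h₂
  -- the `ξ`-coinvariants of `Θ_{s₁}(χ₁)|_{U(J₁)}` are non-zero (★ `coinvLineEquiv` backwards)
  have e₁ := (coinvLineEquiv F E c hcδ₁ hδ₁ hd₁ v 1 n₂ hT₁ hT₂ hT₁d hT₂d hJ₁ hJ₂ hJ s₁ hs₁ hJ' ξ χ₁).toEquiv.nontrivial_congr
  have hΘ₁ := e₁.2 (nontrivial_tensor_iff.2 ⟨h₁, h₂⟩)
  -- transport along the isomorphism, restricted to the first block `u ↦ u ⊕ 1`
  have hΘ₂ := (nontrivial_coinv_comp_iff_of_areIsomorphicRep hiso (inlLoc F E c v 1 n₂ hJ₁ hJ) ξ).1 hΘ₁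
  -- split the `ξ`-coinvariants of `Θ_{s₂}(χ₂)|_{U(J₁)}` (★ `coinvLineEquiv` for `s₂`): `ξ` is a type of `ω_{s₂,1}` as well
  have e₂ := (coinvLineEquiv F E c hcδ₂ hδ₂ hd₂ v 1 n₂ hT₁ hT₂ hT₁d hT₂d hJ₁ hJ₂ hJ s₂ hs₂ hJ' ξ χ₂).toEquiv.nontrivial_congr
  exact hcomp ξ hξo hξu hξc h₁ (nontrivial_tensor_iff.1 (e₂.1 hΘ₂)).1

/-! ## §2 Complementarity from the `θ = 1` dichotomy (consumer glue for the organ (P′)) -/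

-- two block-currency terms + the compact-torus dictionary: about 2× the default budget
set_option maxHeartbeats 400000 in
include hT₁d in
/-- **BLOCK-0 COMPLEMENTARITY FROM THE `θ = 1` DICHOTOMY.**  If the two first-block oscillator representations `ω^{T₁} ∘ restrictLeft s₁`,
`ω^{T₁} ∘ restrictLeft s₂` (sections over `ι^{T₁}_{δ₁}`, `ι^{T₁}_{δ₂}` by ★ `proj_restrictLeft`) satisfy the conclusion of ★ `rankOne_theta_dichotomy`
with TRIVIAL character — `dim ω₁[ξ] + dim ω₂[ξ] = 1` for every open-kernel `ξ` — then no open-kernel unitary continuous `ξ` has non-zero coinvariants on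
both (the hypothesis `hcomp` of `rankOne_theta_lines_disjoint_of_blockComplement`): on the compact torus `U(J₁)(F_v)` the `ξ`-isotypic subspace maps ONTO
the `ξ`-coinvariants (★ `bijective_mk_domRestrict_weightSpace`), and both weight spaces are finite-dimensional (★ `finiteDimensional_weightSpace_rankOne`),
so two non-zero coinvariant spaces would give `dim ω₁[ξ] + dim ω₂[ξ] ≥ 2`.
[cite: MoeglinVignerasWaldspurger1987, Chap. 3 §IV.4; Chap. 2 II.2] [cite: HarrisKudlaSweet1996, Cor. 4.4 p. 962] [cite: SunZhu2014, Thm. 1.10] -/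
theorem blockComplement_of_finrank_weightSpace_add_eq_one (hE : IsField (UnitaryGroup.LocalRing E v))
    (hsm₁ : Representation.IsSmooth ((MpPsi.toRep (localSchrodinger F (1 + n₂) (UnitaryGroup.finSum 1 n₂ T₁ T₂) v)).comp s₁))
    (hsm₂ : Representation.IsSmooth ((MpPsi.toRep (localSchrodinger F (1 + n₂) (UnitaryGroup.finSum 1 n₂ T₁ T₂) v)).comp s₂))
    (hdich : ∀ ξ : (UnitaryGroup.localPi E c 1 J₁ v) →* ℂˣ, IsOpen (ξ.ker : Set (UnitaryGroup.localPi E c 1 J₁ v)) →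
      Module.finrank ℂ (weightSpace ((MpPsi.toRep (localSchrodinger F 1 T₁ v)).comp
          (restrictLeft F E c v 1 n₂ hJ₁ hJ hcδ₁ hδ₁ hd₁ hT₁ hT₂ hT₂d s₁ hs₁)) id (fun k => ((ξ k : ℂˣ) : ℂ))) +
        Module.finrank ℂ (weightSpace ((MpPsi.toRep (localSchrodinger F 1 T₁ v)).comp
          (restrictLeft F E c v 1 n₂ hJ₁ hJ hcδ₂ hδ₂ hd₂ hT₁ hT₂ hT₂d s₂ hs₂)) id (fun k => ((ξ k : ℂˣ) : ℂ))) = 1) :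
    ∀ ξ : (UnitaryGroup.localPi E c 1 J₁ v) →* ℂˣ, IsOpen (ξ.ker : Set (UnitaryGroup.localPi E c 1 J₁ v)) →
      (∀ u, ‖((ξ u : ℂˣ) : ℂ)‖ = 1) → (Continuous fun u => ((ξ u : ℂˣ) : ℂ)) →
      Nontrivial (Coinv ((MpPsi.toRep (localSchrodinger F 1 T₁ v)).comp
        (restrictLeft F E c v 1 n₂ hJ₁ hJ hcδ₁ hδ₁ hd₁ hT₁ hT₂ hT₂d s₁ hs₁)) ξ) →
      Nontrivial (Coinv ((MpPsi.toRep (localSchrodinger F 1 T₁ v)).comp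
        (restrictLeft F E c v 1 n₂ hJ₁ hJ hcδ₂ hδ₂ hd₂ hT₁ hT₂ hT₂d s₂ hs₂)) ξ) → False := by
  intro ξ hξo hξu hξc h₁ h₂
  haveI : CompactSpace (UnitaryGroup.localPi E c 1 J₁ v) := compactSpace_localPi_rankOne F E c hcδ₁ hδ₁ hT₁d hJ₁ v hE
  -- the two block sections are smooth sections over `ι^{T₁}_{δᵢ}`
  have hsm₁' := isSmooth_restrictLeft F E c v 1 n₂ hJ₁ hJ hcδ₁ hδ₁ hd₁ hT₁ hT₂ hT₂d s₁ hs₁ hsm₁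
  have hsm₂' := isSmooth_restrictLeft F E c v 1 n₂ hJ₁ hJ hcδ₂ hδ₂ hd₂ hT₁ hT₂ hT₂d s₂ hs₂ hsm₂
  -- multiplicity one: both weight spaces are finite-dimensional
  have fin₁ := finiteDimensional_weightSpace_rankOne F E c hcδ₁ hδ₁ hd₁ hT₁ hT₁d hJ₁ v hE
    (restrictLeft F E c v 1 n₂ hJ₁ hJ hcδ₁ hδ₁ hd₁ hT₁ hT₂ hT₂d s₁ hs₁)
    (proj_restrictLeft F E c v 1 n₂ hJ₁ hJ hcδ₁ hδ₁ hd₁ hT₁ hT₂ hT₂d s₁ hs₁) hsm₁' ξ hξu hξc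
  have fin₂ := finiteDimensional_weightSpace_rankOne F E c hcδ₂ hδ₂ hd₂ hT₁ hT₁d hJ₁ v hE
    (restrictLeft F E c v 1 n₂ hJ₁ hJ hcδ₂ hδ₂ hd₂ hT₁ hT₂ hT₂d s₂ hs₂)
    (proj_restrictLeft F E c v 1 n₂ hJ₁ hJ hcδ₂ hδ₂ hd₂ hT₁ hT₂ hT₂d s₂ hs₂) hsm₂' ξ hξu hξc
  haveI := fin₁.1
  haveI := fin₂.1
  -- the compact-torus dictionary: non-zero coinvariants come from non-zero isotypic subspaces
  have hw₁ := (bijective_mk_domRestrict_weightSpace _ ξ hsm₁' hξo).2.nontrivial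
  have hw₂ := (bijective_mk_domRestrict_weightSpace _ ξ hsm₂' hξo).2.nontrivial
  have hp₁ := (Module.finrank_pos_iff (R := ℂ)).2 hw₁
  have hp₂ := (Module.finrank_pos_iff (R := ℂ)).2 hw₂
  have h := hdich ξ hξo
  omega

/-! ## §3 (edition 3) The composite: disjointness from the `θ = 1` TRACE RELATION of the two block-0 sections — the (P′) socket shape -/

section TraceRelation

open Literature.NumberTheory.Automorphic.UnitaryGroup

-- three block-currency theorems composed; the measure ∕ conductor data of ★ thm A are supplied internally
set_option maxHeartbeats 400000 in
include hT₁d hJ₂ in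
/-- **DISJOINTNESS FROM THE BLOCK-0 TRACE RELATION** (the composite ★ `rankOne_finrank_weightSpace_add_eq_one_of_trace_eq_neg` (p850122, at
`t := T₁`, `sᵢ := restrictLeft … sᵢ hsᵢ`) ∘ §2 `blockComplement_of_finrank_weightSpace_add_eq_one` ∘ §1 `rankOne_theta_lines_disjoint_of_blockComplement`):
if the two first-block oscillator representations have OPPOSITE finite-level traces near every `z ∉ {1, −1}` of `U(J₁)(F_v)` — the hypothesis `hrel`,
VERBATIM the `hrel` of ★ thm A for the sections `restrictLeft s₁`, `restrictLeft s₂` (this is the SOCKET the organ (P′) of the line LD2 pays for the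
same-`λ` CM packages of two lines `a ≁_v a′`) — then `Θ_{s₁}(χ₁) ≠ 0` and `Θ_{s₁}(χ₁) ≅ Θ_{s₂}(χ₂)` are incompatible.  The auxiliary Haar measure and
conductor exponent of `ψ_v` that thm A wants are supplied here (`borel`, `Measure.addHaar`, ★ `isContinuousNontrivial_adeleAddCharAt`), so the
socket is measure-free. [cite: MoeglinVignerasWaldspurger1987, Chap. 3 §IV.4 Théorème principal; Chap. 2 II.1 Rem. (6)] [cite: HarrisKudlaSweet1996, Cor. 4.4 p. 962]
[cite: SunZhu2014, Thm. 1.10] [cite: Liu2021, App. D Lemma D.1 (4) (p. 125–126)] -/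
theorem rankOne_theta_lines_disjoint_of_blockZero_trace_eq_neg (hE : IsField (UnitaryGroup.LocalRing E v))
    (hsm₁ : Representation.IsSmooth ((MpPsi.toRep (localSchrodinger F (1 + n₂) (UnitaryGroup.finSum 1 n₂ T₁ T₂) v)).comp s₁))
    (hsm₂ : Representation.IsSmooth ((MpPsi.toRep (localSchrodinger F (1 + n₂) (UnitaryGroup.finSum 1 n₂ T₁ T₂) v)).comp s₂))
    (hrel : ∀ z : localPi E c 1 J₁ v, z ≠ 1 → z ≠ localUnitScalar E c J₁ v (-1) (negOne_mul_conjLocal_negOne E c v) →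
      ∃ K₀ : Subgroup (localPi E c 1 J₁ v), IsOpen (K₀ : Set (localPi E c 1 J₁ v)) ∧
        ∀ u : localPi E c 1 J₁ v, z⁻¹ * u ∈ K₀ →
          ∀ L : Subgroup (localPi E c 1 J₁ v), IsOpen (L : Set (localPi E c 1 J₁ v)) → L ≤ K₀ →
            LinearMap.trace ℂ (Representation.fixedPoints ((MpPsi.toRep (localSchrodinger F 1 T₁ v)).comp (restrictLeft F E c v 1 n₂ hJ₁ hJ hcδ₂ hδ₂ hd₂ hT₁ hT₂ hT₂d s₂ hs₂)) L)
                (((((MpPsi.toRep (localSchrodinger F 1 T₁ v)).comp (restrictLeft F E c v 1 n₂ hJ₁ hJ hcδ₂ hδ₂ hd₂ hT₁ hT₂ hT₂d s₂ hs₂))) u).restrict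
                  (apply_mem_fixedPoints_of_comm ((MpPsi.toRep (localSchrodinger F 1 T₁ v)).comp (restrictLeft F E c v 1 n₂ hJ₁ hJ hcδ₂ hδ₂ hd₂ hT₁ hT₂ hT₂d s₂ hs₂))
                    (localPi_one_mul_comm E c J₁ v) L u)) =
              -(LinearMap.trace ℂ (Representation.fixedPoints ((MpPsi.toRep (localSchrodinger F 1 T₁ v)).comp (restrictLeft F E c v 1 n₂ hJ₁ hJ hcδ₁ hδ₁ hd₁ hT₁ hT₂ hT₂d s₁ hs₁)) L)
                  (((((MpPsi.toRep (localSchrodinger F 1 T₁ v)).comp (restrictLeft F E c v 1 n₂ hJ₁ hJ hcδ₁ hδ₁ hd₁ hT₁ hT₂ hT₂d s₁ hs₁))) u).restrict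
                    (apply_mem_fixedPoints_of_comm ((MpPsi.toRep (localSchrodinger F 1 T₁ v)).comp (restrictLeft F E c v 1 n₂ hJ₁ hJ hcδ₁ hδ₁ hd₁ hT₁ hT₂ hT₂d s₁ hs₁))
                      (localPi_one_mul_comm E c J₁ v) L u))))
    (χ₁ χ₂ : (localPi E c 1 J' v) →* ℂˣ)
    (hnt : Nontrivial (Coinv ((((MpPsi.toRep (localSchrodinger F (1 + n₂) (UnitaryGroup.finSum 1 n₂ T₁ T₂) v)).comp s₁)).comp
      (UnitaryGroup.localCenter E c (1 + n₂) J J' hJ' v)) χ₁))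
    (hiso : AreIsomorphicRep
      (rep (ρW := (((MpPsi.toRep (localSchrodinger F (1 + n₂) (UnitaryGroup.finSum 1 n₂ T₁ T₂) v)).comp s₁)).comp
          (UnitaryGroup.localCenter E c (1 + n₂) J J' hJ' v)) χ₁
        ((MpPsi.toRep (localSchrodinger F (1 + n₂) (UnitaryGroup.finSum 1 n₂ T₁ T₂) v)).comp s₁)
        (fun g z => (show Commute g ((UnitaryGroup.localCenter E c (1 + n₂) J J' hJ' v) z) from
          UnitaryGroup.localCenter_comm E c (1 + n₂) J J' hJ' v z g).map
            ((MpPsi.toRep (localSchrodinger F (1 + n₂) (UnitaryGroup.finSum 1 n₂ T₁ T₂) v)).comp s₁)))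
      (rep (ρW := (((MpPsi.toRep (localSchrodinger F (1 + n₂) (UnitaryGroup.finSum 1 n₂ T₁ T₂) v)).comp s₂)).comp
          (UnitaryGroup.localCenter E c (1 + n₂) J J' hJ' v)) χ₂
        ((MpPsi.toRep (localSchrodinger F (1 + n₂) (UnitaryGroup.finSum 1 n₂ T₁ T₂) v)).comp s₂)
        (fun g z => (show Commute g ((UnitaryGroup.localCenter E c (1 + n₂) J J' hJ' v) z) from
          UnitaryGroup.localCenter_comm E c (1 + n₂) J J' hJ' v z g).map
            ((MpPsi.toRep (localSchrodinger F (1 + n₂) (UnitaryGroup.finSum 1 n₂ T₁ T₂) v)).comp s₂)))) :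
    False := by
  letI : MeasurableSpace (v.adicCompletion F) := borel _
  haveI : BorelSpace (v.adicCompletion F) := ⟨rfl⟩
  obtain ⟨m, hm⟩ := (isContinuousNontrivial_adeleAddCharAt F v).exists_hasConductorExp
  -- thm A at `t := T₁`, `sᵢ := restrictLeft sᵢ` (sections over `ι^{T₁}_{δᵢ}` by ★ `proj_restrictLeft`, smooth by ★ `isSmooth_restrictLeft`)
  have hdich := rankOne_finrank_weightSpace_add_eq_one_of_trace_eq_neg F E c δ₁ hcδ₁ hδ₁ d₁ hd₁ δ₂ hcδ₂ hδ₂ d₂ hd₂ T₁ hT₁ hT₁d J₁ hJ₁ v hE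
    (restrictLeft F E c v 1 n₂ hJ₁ hJ hcδ₁ hδ₁ hd₁ hT₁ hT₂ hT₂d s₁ hs₁) (proj_restrictLeft F E c v 1 n₂ hJ₁ hJ hcδ₁ hδ₁ hd₁ hT₁ hT₂ hT₂d s₁ hs₁)
    (isSmooth_restrictLeft F E c v 1 n₂ hJ₁ hJ hcδ₁ hδ₁ hd₁ hT₁ hT₂ hT₂d s₁ hs₁ hsm₁)
    (restrictLeft F E c v 1 n₂ hJ₁ hJ hcδ₂ hδ₂ hd₂ hT₁ hT₂ hT₂d s₂ hs₂) (proj_restrictLeft F E c v 1 n₂ hJ₁ hJ hcδ₂ hδ₂ hd₂ hT₁ hT₂ hT₂d s₂ hs₂)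
    (isSmooth_restrictLeft F E c v 1 n₂ hJ₁ hJ hcδ₂ hδ₂ hd₂ hT₁ hT₂ hT₂d s₂ hs₂ hsm₂)
    MeasureTheory.Measure.addHaar m hm hrel
  exact rankOne_theta_lines_disjoint_of_blockComplement F E c hcδ₁ hδ₁ hd₁ hcδ₂ hδ₂ hd₂ v n₂ hT₁ hT₂ hT₁d hT₂d hJ₁ hJ₂ hJ s₁ hs₁ s₂ hs₂ hJ'
    hE hsm₁ χ₁ χ₂
    (blockComplement_of_finrank_weightSpace_add_eq_one F E c hcδ₁ hδ₁ hd₁ hcδ₂ hδ₂ hd₂ v n₂ hT₁ hT₂ hT₁d hT₂d hJ₁ hJ s₁ hs₁ s₂ hs₂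
      hE hsm₁ hsm₂ hdich)
    hnt hiso

end TraceRelation

end Literature.RepresentationTheory.MoeglinVignerasWaldspurger1987

end
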